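import Summits.CriticalPhenomena.PercolationContinuityZ3.Theorems.Transplant.FKConnectivityAllQPat3KNetPlacePath
import HarnessLib

/-!
# Connectivity correlation inequalities for `φ_{w,q}`, every `q > 0` — THEOREM SP(𝒦): the four PATH-type leaves

Helper file (`--supports stmt-CriticalPhenomena-4575`), census lineage (gen 41) of LANE 2's FK sub-programme; builds on p205010 (kernel
theorem, internal audit signed; external expert review pending).  No definitions, no named facts, no sorries; standard axioms.

Four of the twelve K-state leaf specs of THEOREM SP(𝒦)'s inner bridge branches (census g41 drafts/README), as instances of the generic
PATH placement lemma «Pat3KNetPlacePath» `FK.placeK_path` under corner relabelings: `FK.spGoodC_bridgeLeaf_pathMid` (type I: path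
`c x y d`, `b` in the middle slot `E₂`), `_pathEnd` (type I: path `y x c d`, `b ∈ E₂` at an end), `_pathA` (pc: path `d x c y`, `b ∈ Q_xc` in the
middle), `_pathB` (pc: path `x c d y`, `b ∈ Q_cd` in the middle).
[cite: AyyerLinussonRavichandran2025, §7 (p. 22)]
-/

namespace Summit.CriticalPhenomena.PercolationContinuityZ3.Theorems

namespace FK

open scoped Classical

variable {V : Type*} [Fintype V] {N₀ : Finset (Sym2 V)} {Qac Qad Qbc Qbd Qcd E₂ E C : Finset (Sym2 V)} {x y c d b s t : V}

/-- **LEAF `pathMid` (type I)**: `s ∈ Q_xc`, `b ∈ E₂`, `t ∈ Q_yd` — the path `c x y d`. [cite: AyyerLinussonRavichandran2025, §7 (p. 22)] -/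
theorem spGoodC_bridgeLeaf_pathMid
    (ihSP : ∀ {N' E' C' : Finset (Sym2 V)} {x' y' b' s' t' : V}, N'.card < N₀.card → IsKNet N' x' y' → E' ⊆ N' → C' ⊆ N' →
      (∃ e ∈ N', b' ∈ e) → (∃ e ∈ N', s' ∈ e) → (∃ e ∈ N', t' ∈ e) → b' ≠ s' → b' ≠ t' → s' ≠ t' → SPGoodC E' C' b' s' t')
    (hac : IsKNet Qac x c) (had : IsKNet Qad x d) (hbc : IsKNet Qbc y c) (hbd : IsKNet Qbd y d) (hcd : IsKNet Qcd c d)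
    (hsep : BridgeSep Qac Qad Qbc Qbd Qcd x y c d) (h₂ : IsKNet E₂ x y) (hd : Disjoint (Qac ∪ Qad ∪ Qbc ∪ Qbd ∪ Qcd) E₂) (hN : Qac ∪ Qad ∪ Qbc ∪ Qbd ∪ Qcd ∪ E₂ ⊆ N₀)
    (hV : ∀ z : V, (∃ e ∈ Qac ∪ Qad ∪ Qbc ∪ Qbd ∪ Qcd, z ∈ e) → (∃ e ∈ E₂, z ∈ e) → z = x ∨ z = y)
    (hE : E ⊆ Qac ∪ Qad ∪ Qbc ∪ Qbd ∪ Qcd ∪ E₂) (hC : C ⊆ Qac ∪ Qad ∪ Qbc ∪ Qbd ∪ Qcd ∪ E₂)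
    (hs : ∃ e ∈ Qac, s ∈ e) (hsx : s ≠ x) (hsc : s ≠ c) (ht : ∃ e ∈ Qbd, t ∈ e) (hty : t ≠ y) (htd : t ≠ d)
    (hb : ∃ e ∈ E₂, b ∈ e) (hbx : b ≠ x) (hby : b ≠ y) : SPGoodC E C b s t := by
  have K := (k4Sep_of_bridge_par hac had hbc hbd hsep hd hV).swap_ac.swap_bc
  have eN : Qac ∪ Qad ∪ Qbc ∪ Qbd ∪ Qcd ∪ E₂ = Qac ∪ (Qbc ∪ Qcd ∪ E₂ ∪ Qad ∪ Qbd) := by ac_rfl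
  rw [eN] at hN hE hC
  exact (placeK_path ihSP K hac.symm hbc.symm hcd h₂ had hbd hN hs hsc hsx hb hbx hby ht hty htd hE hC).swap12

/-- **LEAF `pathEnd` (type I)**: `b ∈ E₂`, `s ∈ Q_xc`, `t ∈ Q_cd` — the path `y x c d`. [cite: AyyerLinussonRavichandran2025, §7 (p. 22)] -/
theorem spGoodC_bridgeLeaf_pathEnd
    (ihSP : ∀ {N' E' C' : Finset (Sym2 V)} {x' y' b' s' t' : V}, N'.card < N₀.card → IsKNet N' x' y' → E' ⊆ N' → C' ⊆ N' →
      (∃ e ∈ N', b' ∈ e) → (∃ e ∈ N', s' ∈ e) → (∃ e ∈ N', t' ∈ e) → b' ≠ s' → b' ≠ t' → s' ≠ t' → SPGoodC E' C' b' s' t')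
    (hac : IsKNet Qac x c) (had : IsKNet Qad x d) (hbc : IsKNet Qbc y c) (hbd : IsKNet Qbd y d) (hcd : IsKNet Qcd c d)
    (hsep : BridgeSep Qac Qad Qbc Qbd Qcd x y c d) (h₂ : IsKNet E₂ x y) (hd : Disjoint (Qac ∪ Qad ∪ Qbc ∪ Qbd ∪ Qcd) E₂) (hN : Qac ∪ Qad ∪ Qbc ∪ Qbd ∪ Qcd ∪ E₂ ⊆ N₀)
    (hV : ∀ z : V, (∃ e ∈ Qac ∪ Qad ∪ Qbc ∪ Qbd ∪ Qcd, z ∈ e) → (∃ e ∈ E₂, z ∈ e) → z = x ∨ z = y)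
    (hE : E ⊆ Qac ∪ Qad ∪ Qbc ∪ Qbd ∪ Qcd ∪ E₂) (hC : C ⊆ Qac ∪ Qad ∪ Qbc ∪ Qbd ∪ Qcd ∪ E₂)
    (hs : ∃ e ∈ Qac, s ∈ e) (hsx : s ≠ x) (hsc : s ≠ c) (ht : ∃ e ∈ Qcd, t ∈ e) (htc : t ≠ c) (htd : t ≠ d)
    (hb : ∃ e ∈ E₂, b ∈ e) (hbx : b ≠ x) (hby : b ≠ y) : SPGoodC E C b s t := by
  have K := (k4Sep_of_bridge_par hac had hbc hbd hsep hd hV).swap_ab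
  have eN : Qac ∪ Qad ∪ Qbc ∪ Qbd ∪ Qcd ∪ E₂ = E₂ ∪ (Qbc ∪ Qbd ∪ Qac ∪ Qad ∪ Qcd) := by ac_rfl
  rw [eN] at hN hE hC
  exact placeK_path ihSP K h₂.symm hbc hbd hac had hcd hN hb hby hbx hs hsx hsc ht htc htd hE hC

/-- **LEAF `pathA` (pc)**: `s ∈ Q_xd`, `b ∈ Q_xc`, `t ∈ Q_yc` — the path `d x c y`. [cite: AyyerLinussonRavichandran2025, §7 (p. 22)] -/
theorem spGoodC_bridgeLeaf_pathA
    (ihSP : ∀ {N' E' C' : Finset (Sym2 V)} {x' y' b' s' t' : V}, N'.card < N₀.card → IsKNet N' x' y' → E' ⊆ N' → C' ⊆ N' →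
      (∃ e ∈ N', b' ∈ e) → (∃ e ∈ N', s' ∈ e) → (∃ e ∈ N', t' ∈ e) → b' ≠ s' → b' ≠ t' → s' ≠ t' → SPGoodC E' C' b' s' t')
    (hac : IsKNet Qac x c) (had : IsKNet Qad x d) (hbc : IsKNet Qbc y c) (hbd : IsKNet Qbd y d) (hcd : IsKNet Qcd c d)
    (hsep : BridgeSep Qac Qad Qbc Qbd Qcd x y c d) (h₂ : IsKNet E₂ x y) (hd : Disjoint (Qac ∪ Qad ∪ Qbc ∪ Qbd ∪ Qcd) E₂) (hN : Qac ∪ Qad ∪ Qbc ∪ Qbd ∪ Qcd ∪ E₂ ⊆ N₀)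
    (hV : ∀ z : V, (∃ e ∈ Qac ∪ Qad ∪ Qbc ∪ Qbd ∪ Qcd, z ∈ e) → (∃ e ∈ E₂, z ∈ e) → z = x ∨ z = y)
    (hE : E ⊆ Qac ∪ Qad ∪ Qbc ∪ Qbd ∪ Qcd ∪ E₂) (hC : C ⊆ Qac ∪ Qad ∪ Qbc ∪ Qbd ∪ Qcd ∪ E₂)
    (hb : ∃ e ∈ Qac, b ∈ e) (hbx : b ≠ x) (hbc' : b ≠ c) (hs : ∃ e ∈ Qad, s ∈ e) (hsx : s ≠ x) (hsd : s ≠ d)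
    (ht : ∃ e ∈ Qbc, t ∈ e) (hty : t ≠ y) (htc : t ≠ c) : SPGoodC E C b s t := by
  have K := (k4Sep_of_bridge_par hac had hbc hbd hsep hd hV).swap_cd.swap_ac.swap_bc.swap_cd
  have eN : Qac ∪ Qad ∪ Qbc ∪ Qbd ∪ Qcd ∪ E₂ = Qad ∪ (Qcd ∪ Qbd ∪ Qac ∪ E₂ ∪ Qbc) := by ac_rfl
  rw [eN] at hN hE hC
  exact (placeK_path ihSP K had.symm hcd.symm hbd.symm hac h₂ hbc.symm hN hs hsd hsx hb hbx hbc' ht htc hty hE hC).swap12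

/-- **LEAF `pathB` (pc)**: `s ∈ Q_xc`, `b ∈ Q_cd`, `t ∈ Q_yd` — the path `x c d y`. [cite: AyyerLinussonRavichandran2025, §7 (p. 22)] -/
theorem spGoodC_bridgeLeaf_pathB
    (ihSP : ∀ {N' E' C' : Finset (Sym2 V)} {x' y' b' s' t' : V}, N'.card < N₀.card → IsKNet N' x' y' → E' ⊆ N' → C' ⊆ N' →
      (∃ e ∈ N', b' ∈ e) → (∃ e ∈ N', s' ∈ e) → (∃ e ∈ N', t' ∈ e) → b' ≠ s' → b' ≠ t' → s' ≠ t' → SPGoodC E' C' b' s' t')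
    (hac : IsKNet Qac x c) (had : IsKNet Qad x d) (hbc : IsKNet Qbc y c) (hbd : IsKNet Qbd y d) (hcd : IsKNet Qcd c d)
    (hsep : BridgeSep Qac Qad Qbc Qbd Qcd x y c d) (h₂ : IsKNet E₂ x y) (hd : Disjoint (Qac ∪ Qad ∪ Qbc ∪ Qbd ∪ Qcd) E₂) (hN : Qac ∪ Qad ∪ Qbc ∪ Qbd ∪ Qcd ∪ E₂ ⊆ N₀)
    (hV : ∀ z : V, (∃ e ∈ Qac ∪ Qad ∪ Qbc ∪ Qbd ∪ Qcd, z ∈ e) → (∃ e ∈ E₂, z ∈ e) → z = x ∨ z = y)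
    (hE : E ⊆ Qac ∪ Qad ∪ Qbc ∪ Qbd ∪ Qcd ∪ E₂) (hC : C ⊆ Qac ∪ Qad ∪ Qbc ∪ Qbd ∪ Qcd ∪ E₂)
    (hb : ∃ e ∈ Qcd, b ∈ e) (hbc' : b ≠ c) (hbd' : b ≠ d) (hs : ∃ e ∈ Qac, s ∈ e) (hsx : s ≠ x) (hsc : s ≠ c)
    (ht : ∃ e ∈ Qbd, t ∈ e) (hty : t ≠ y) (htd : t ≠ d) : SPGoodC E C b s t := by
  have K := (k4Sep_of_bridge_par hac had hbc hbd hsep hd hV).swap_bc.swap_cd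
  have eN : Qac ∪ Qad ∪ Qbc ∪ Qbd ∪ Qcd ∪ E₂ = Qac ∪ (Qad ∪ E₂ ∪ Qcd ∪ Qbc ∪ Qbd) := by ac_rfl
  rw [eN] at hN hE hC
  exact (placeK_path ihSP K hac had h₂ hcd hbc.symm hbd.symm hN hs hsx hsc hb hbc' hbd' ht htd hty hE hC).swap12

end FK

end Summit.CriticalPhenomena.PercolationContinuityZ3.Theorems
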